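import Summits.ResolutionOfSingularities.ResolutionOfSingularities.Theorems.HilbertSamuelEliminationSigmaMaxModificationsCorridor3WLadderIsoInsepQuadraticCharTwo
import Summits.ResolutionOfSingularities.ResolutionOfSingularities.Theorems.HilbertSamuelEliminationSigmaMaxModificationsCorridor3WLadderE1TangentConeTransport
import Literature.RingTheory.HilbertSamuel.TangentConeChangeOfGenerators
import Literature.AlgebraicGeometry.Resolution.HironakaDirectrixPrincipal
import HarnessLib

/-!
# [OURS · L1 W4.2] E2 chart calculus, brick 2: THE INITIAL FORM OF AN E2 STAGE — for a hypersurface presentation `σ : R ↠ 𝒪`, `ker σ = (h)`,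
# `ord h = 2`, of a local ring with `e(𝒪) = d − 2` and `ē(𝒪) = d − 1` (residue characteristic two), the initial form of `h` is
# `c·(M₁² + λM₂²)`, `λ ∉ κ²` (crux chain w42, cell k2 `T3insep` = `stub_isoInsepTower`; `--supports stmt-ResolutionOfSingularities-19249`)

OURS (cell res-hironaka, slot W4.2, seat res-D-pv-042; OWN OBJECT TUO 15:58Z, brick 2 announced 16:15:04Z); NOT a statement of
[Hironaka2017] nor of [CossartJannsenSaito2020] / [CossartPiltant2008]. AI-drafted, weaker than expert review. PROOF file, def-free, fact-free.

The dictionary step between the k2 rows' abstract directrix data (`Scheme.dirDim`, `Scheme.geomDirDim` of the stalk, as in `IdeasL1C6.IsE2Stage`: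
`e = 2`, `ē = 3` in embedding dimension `4`) and the explicit E2 shape `in h ≅ x² + λy²`:
* `exists_normalForm_initialForm_of_dirDim` — `R` regular local with regular parameters `y` (`emb.dim R = d`), `σ : R ↠ A` with `ker σ = (h)`,
  `h ∈ 𝔪² ∖ 𝔪³`, `F` an initial form of `h` of degree `2`, `char κ(A) = 2`, `dirDim A + 2 = d`, `geomDirDim A + 1 = d` ⇒ along the residue
  isomorphism `κ : κ(R) → κ(A)` of the presentation, `κ F = c·((Σ sᵢYᵢ)² + λ(Σ tᵢYᵢ)²)` with `s, t` independent, `c ≠ 0`, `λ ∉ κ(A)²`.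
  Sockets: res-L1-w42-stub-3's LEMMA T `E1Free.exists_tangentConeIdeal_eq_map_span_singleton` (`J_A = (F)` along `κ`),
  `dirDim_eq'` / `dirDimOver_eq'` (Literature `TangentConeChangeOfGenerators`), `directrixDim_span_singleton` (`e((F)) = d − τ({F})`,
  Literature `HironakaDirectrixPrincipal`), and brick 1 `exists_normalForm_of_hironakaTau_eq_two_of_extension` (p546784).
-/

noncomputable section

set_option linter.dupNamespace false

open scoped Classical
open IsLocalRing MvPolynomial Module
open Literature.RingTheory.MvPolynomial Literature.RingTheory.HilbertSamuel Literature.AlgebraicGeometry.Resolution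
open Summit.ResolutionOfSingularities.ResolutionOfSingularities.Theorems.SigmaMaxModificationsCorridor3

namespace Summit.ResolutionOfSingularities.ResolutionOfSingularities.Cruxes.SigmaMaxModifications.IdeasL1C6

universe u

/-- The image of a principal ideal under `MvPolynomial.map`. [folklore] -/
theorem map_span_singleton_mvPolynomial {K L : Type u} [CommRing K] [CommRing L] (φ : K →+* L) {n : ℕ} (F : MvPolynomial (Fin n) K) :
    (Ideal.span {F}).map (MvPolynomial.map φ) = Ideal.span {MvPolynomial.map φ F} := by
  rw [Ideal.map_span, Set.image_singleton]

/-- `e((F)) = d − τ({F})` read as `τ({F}) = d − e((F))` for a non-zero form whose directrix dimension is known. [folklore] -/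
theorem hironakaTau_eq_of_directrixDim_span_singleton {K : Type u} [Field K] {n : ℕ} {F : MvPolynomial (Fin n) K} {b : ℕ}
    (hF : F.IsHomogeneous b) (h0 : F ≠ 0) {e : ℕ} (he : directrixDim (Ideal.span {F}) = e) :
    hironakaTau K ({F} : Set (MvPolynomial (Fin n) K)) = n - e := by
  rw [directrixDim_span_singleton hF h0] at he
  have := hironakaTau_le K ({F} : Set (MvPolynomial (Fin n) K))
  omega

/-- **THE INITIAL FORM OF AN E2 STAGE.** `R` regular local with regular parameters `y : Fin d → R`, `σ : R ↠ A` a surjection onto a local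
ring with `ker σ = (h)`, `h ∈ 𝔪_R² ∖ 𝔪_R³`, `F` an initial form of `h` (degree `2`), residue characteristic `2`.  If `dirDim A + 2 = d` and
`geomDirDim A + 1 = d` (`e = d − 2 < d − 1 = ē`: the E2 type), then along the residue-field isomorphism `κ` of the presentation
`κ F = c·(M₁² + λM₂²)` with `M₁ = Σ sᵢYᵢ`, `M₂ = Σ tᵢYᵢ` linearly independent, `c ≠ 0`, `λ` NOT a square. [OURS · L1 W4.2 · k2 · E2 chart
calculus, brick 2] [folklore] -/
theorem exists_normalForm_initialForm_of_dirDim {R A : Type u} [CommRing R] [IsRegularLocalRing R] [CommRing A] [IsLocalRing A]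
    [IsNoetherianRing A] [CharP (ResidueField A) 2] {d : ℕ} (hd : (maximalIdeal R).spanFinrank = d) (y : Fin d → R)
    (hy : Ideal.span (Set.range y) = maximalIdeal R) (σ : R →+* A) (hσ : Function.Surjective σ) {h : R}
    (hker : RingHom.ker σ = Ideal.span {h}) (h2 : h ∈ maximalIdeal R ^ 2) (h3 : h ∉ maximalIdeal R ^ (2 + 1))
    {F : MvPolynomial (Fin d) (ResidueField R)} (hF : F ∈ initialFormsOf y h 2)
    (he : dirDim A + 2 = d) (hgeom : geomDirDim A + 1 = d) :
    ∃ (κ : ResidueField R →+* ResidueField A) (s t : Fin d → ResidueField A) (c lam : ResidueField A),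
      Function.Bijective κ ∧ LinearIndependent (ResidueField A) ![s, t] ∧ c ≠ 0 ∧ (∀ u : ResidueField A, u ^ 2 ≠ lam) ∧
      MvPolynomial.map κ F = C c * (linForm s ^ 2 + C lam * linForm t ^ 2) := by
  have hσy : Ideal.span (Set.range (σ ∘ y)) = maximalIdeal A := E1Free.span_range_comp_eq_maximalIdeal hy σ hσ
  obtain ⟨κ, hκ, hJ⟩ := E1Free.exists_tangentConeIdeal_eq_map_span_singleton hd y hy σ hσ hker h2 h3 hF hσy
  have hd1 : 1 ≤ d := by omega
  have hdA : (maximalIdeal A).spanFinrank = d := E1Free.spanFinrank_maximalIdeal_eq_of_presentation hd σ hσ hker le_rfl h2 h3 hd1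
  set G := MvPolynomial.map κ F with hG
  rw [map_span_singleton_mvPolynomial] at hJ
  have hGhom : G.IsHomogeneous 2 := (isHomogeneous_of_mem_initialFormsOf y hF).map κ
  -- `e(A) = e((G))`
  have hdir : dirDim A = directrixDim (Ideal.span {G}) := by rw [dirDim_eq' A hdA (σ ∘ y) hσy, hJ]
  -- `G ≠ 0` (else `e(A) = d`)
  have hG0 : G ≠ 0 := by
    intro h0
    rw [h0, Ideal.span_singleton_zero, directrixDim_bot] at hdir
    omega
  -- `τ_{κ(A)}({G}) = 2`
  have hτ : hironakaTau (ResidueField A) ({G} : Set (MvPolynomial (Fin d) (ResidueField A))) = 2 := by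
    rw [hironakaTau_eq_of_directrixDim_span_singleton hGhom hG0 hdir.symm]; omega
  -- `τ_{κ̄}({Ḡ}) = 1`
  set L := AlgebraicClosure (ResidueField A) with hL
  have hgeom' : dirDimOver A L = directrixDim (Ideal.span {MvPolynomial.map (algebraMap (ResidueField A) L) G}) := by
    rw [dirDimOver_eq' A L hdA (σ ∘ y) hσy, hJ, map_span_singleton_mvPolynomial]
  have hGL0 : MvPolynomial.map (algebraMap (ResidueField A) L) G ≠ 0 := fun h0 =>
    hG0 ((map_injective _ (algebraMap (ResidueField A) L).injective).eq_iff' (map_zero _) |>.mp h0)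
  have hτL : hironakaTau L ({MvPolynomial.map (algebraMap (ResidueField A) L) G} : Set (MvPolynomial (Fin d) L)) ≤ 1 := by
    rw [hironakaTau_eq_of_directrixDim_span_singleton (hGhom.map _) hGL0 hgeom'.symm]
    have : geomDirDim A = dirDimOver A L := rfl
    omega
  obtain ⟨s, t, c, lam, hst, hc, hlam, hEq⟩ := exists_normalForm_of_hironakaTau_eq_two_of_extension hGhom hτ L hτL
  exact ⟨κ, s, t, c, lam, hκ, hst, hc, hlam, hEq⟩

end Summit.ResolutionOfSingularities.ResolutionOfSingularities.Cruxes.SigmaMaxModifications.IdeasL1C6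

end
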